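import Mathlib
import Summits.KontsevichZagierPeriods.Zeta5Search.DenomLaw.ThresholdModelRho

/-!
# ζ(5) search — DENOM-LAW: the threshold model in ρ-coordinates, part 2: the box, event formulas, one-move law, dominance `δ ≤ 4`

Cell `pub-zeta5`, track DENOM-LAW (K1 typing order item (1), «ThresholdModel port»): denom-engine-d2 g11's kernel-checked scratch module
`denom-law/engine-d2/g11/lean/DeepCellLemmas.lean` (THRESHOLD-X3; theory-d1 g9/g10 SELECTION-LAW-PROOF Theorem S) filed VERBATIM in five parts
(≤ 400 lines each; split plan THRESHOLD-X3 §2 (a); docstrings added where the scratch file had none) by denom-prover-d1 g5.  Part 2 of 5.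
HONEST FRAMING: systematic search; MODEL/structure side — elementary integer inequalities of the level model; nothing about ζ(5); no γ; no irrationality claim; records in print UNMOVED.
The full mathematical header (setting, dictionary, what is proved) is the module docstring of part 1 (`ThresholdModelRho.lean`).
-/

namespace Summit.KontsevichZagierPeriods.Zeta5Search.DenomLaw.ThresholdModel.Rho

namespace DeepCell

variable {p R0 : ℤ} {r : Fin 7 → ℤ}

/-- On a deep cell the block parameters are listed in ascending order. -/
theorem r_le (h : DeepCell p R0 r) {i j : Fin 7} (hij : i ≤ j) : r i ≤ r j := h.mono hij

/-! ## The box (S1) -/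

/-- on a deep cell `ρ₁ + ρ₅ ≥ 2p` (all three cases; `λ₁ ≤ 3`). -/
theorem two_p_le_r0_add_r4 (h : DeepCell p R0 r) : 2 * p ≤ r 0 + r 4 := by
  have h34 : r 3 ≤ r 4 := h.r_le (by decide)
  rcases h.deep with ⟨_, h1, _, _⟩ | ⟨_, _, h1, _, _⟩ | ⟨_, _, h1, _⟩ <;> linarith

/-- on a deep cell `ρ₂ + ρ₄ ≥ 2p` (all three cases; `λ₂ ≤ 1`). -/
theorem two_p_le_r1_add_r3 (h : DeepCell p R0 r) : 2 * p ≤ r 1 + r 3 := by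
  have h23 : r 2 ≤ r 3 := h.r_le (by decide)
  rcases h.deep with ⟨_, _, h1, _⟩ | ⟨_, _, _, h1, _⟩ | ⟨_, _, _, h1⟩ <;> linarith

/-- on a deep cell `R₀ − p < ρ₃` (`a ≤ 2`). -/
theorem R0_sub_p_lt_r2 (h : DeepCell p R0 r) : R0 - p < r 2 := by
  have h02 : r 0 ≤ r 2 := h.r_le (by decide)
  have h12 : r 1 ≤ r 2 := h.r_le (by decide)
  rcases h.deep with ⟨h1, _⟩ | ⟨_, h1, _⟩ | ⟨_, h1, _⟩ <;> linarith

/-- **THE BOX, ρ part**: every `ρ_j ≥ 1` (no block attains the extreme length `b₀ − (m−1)p`). -/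
theorem one_le_r (h : DeepCell p R0 r) (j : Fin 7) : 1 ≤ r j := by
  have h0 : 1 ≤ r 0 := by
    have := h.two_p_le_r0_add_r4
    have h45 : r 4 ≤ r 5 := h.r_le (by decide)
    have h46 : r 4 ≤ r 6 := h.r_le (by decide)
    have := h.pair_hi
    linarith
  have : r 0 ≤ r j := h.r_le (Fin.zero_le _)
  linarith

/-- **THE BOX, R₀ part**: `0 ≤ R₀ ≤ 3p − 2`. -/
theorem R0_bounds (h : DeepCell p R0 r) : 0 ≤ R0 ∧ R0 ≤ 3 * p - 2 := by
  have h04 := h.two_p_le_r0_add_r4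
  have h6 := h.point_hi 6
  have h46 : r 4 ≤ r 6 := h.r_le (by decide)
  have h06 : r 0 ≤ r 6 := h.r_le (by decide)
  have h25 : r 2 ≤ r 5 := h.r_le (by decide)
  have h56 : r 5 ≤ r 6 := h.r_le (by decide)
  have hp := h.pair_hi
  have h2 := h.R0_sub_p_lt_r2
  constructor <;> linarith

/-- the box of Theorem S as one statement: `ρ_j ≥ 1 (> 0)` for all j and `0 ≤ R₀ < 3p`. -/
theorem box (h : DeepCell p R0 r) : (∀ j, 1 ≤ r j) ∧ 0 ≤ R0 ∧ R0 < 3 * p :=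
  ⟨h.one_le_r, h.R0_bounds.1, by linarith [h.R0_bounds.2]⟩

/-! ## Exact event formulas between adjacent same-side classes `u → u + 2` (THRESHOLD-X2 §4) -/

/-- one parity step of a threshold count: `[x < T+2] − [x < T] = [x = T]` when `x ≡ T (mod 2)`. -/
theorem indic_step (x T : ℤ) (hx : (x - T) % 2 = 0) :
    indic (x < T + 2) - indic (x < T) = indic (x = T) := by
  unfold indic; split_ifs <;> omega

/-- `L(u+2) − L(u) = #{j : ρ_j = u + p}`. -/
theorem L_step (h : DeepCell p R0 r) {u : ℤ} (hu : (u - R0) % 2 = 0) :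
    L p r (u + 2) - L p r u = countEq r (u + p) := by
  unfold L countLt countEq
  rw [← Finset.sum_sub_distrib]
  apply Finset.sum_congr rfl
  intro j _
  have hj := h.parity j
  have hp := h.odd_p
  rw [show u + 2 + p = (u + p) + 2 by ring]
  exact indic_step (r j) (u + p) (by omega)

/-- `R(u) − R(u+2) = #{j : ρ_j = p − u − 2}`. -/
theorem R_step (h : DeepCell p R0 r) {u : ℤ} (hu : (u - R0) % 2 = 0) :
    R p r u - R p r (u + 2) = countEq r (p - u - 2) := by
  unfold R countLt countEq
  rw [← Finset.sum_sub_distrib]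
  apply Finset.sum_congr rfl
  intro j _
  have hj := h.parity j
  have hp := h.odd_p
  have := indic_step (r j) (p - u - 2) (by omega)
  rw [show p - u - 2 + 2 = p - u by ring] at this
  rw [show p - (u + 2) = p - u - 2 by ring]
  exact this

/-- `n₊(u+2) − n₊(u) = [R₀ = 2p − u − 2]`. -/
theorem np_step {u : ℤ} (hu : (u - R0) % 2 = 0) :
    np p R0 (u + 2) - np p R0 u = indic (R0 = 2 * p - u - 2) := by
  unfold np indic; split_ifs <;> omega

/-- `n₋(u) − n₋(u+2) = [R₀ = 2p + u]`. -/
theorem nm_step {u : ℤ} (hu : (u - R0) % 2 = 0) :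
    nm p R0 u - nm p R0 (u + 2) = indic (R0 = 2 * p + u) := by
  unfold nm indic; split_ifs <;> omega

/-- the defect changes by `up − down` between adjacent same-side classes. -/
theorem delta_step (h : DeepCell p R0 r) {u : ℤ} (hu : (u - R0) % 2 = 0) :
    delta p R0 r (u + 2) - delta p R0 r u = up p R0 r u - down p R0 r u := by
  have h1 := h.L_step hu
  have h2 := h.R_step hu
  have h3 := np_step (p := p) hu
  have h4 := nm_step (p := p) hu
  unfold delta up down
  linarith

/-! ## The adjacent ONE-MOVE law is a theorem of the deep condition (THRESHOLD-X2 §4) -/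

/-- order statistics: `#{j : ρ_j ≤ T} ≥ k + 1 ⇒ ρ_{(k)} ≤ T`. -/
theorem r_le_of_countLe {k : Fin 7} {T : ℤ} (hr : Monotone r) (h : (k : ℤ) + 1 ≤ countLe r T) : r k ≤ T := by
  by_contra hk
  have := countLe_le hr k (not_le.1 hk)
  linarith

/-- **ONE-MOVE LAW.** On a deep cell, for `u ≥ 0`, the adjacent classes `u → u+2` never exchange two roots each way:
`¬ (up ≥ 2 ∧ down ≥ 2)`.  (Cases A/B/C of THRESHOLD-X2 §4: A contradicts `ρ₂+ρ₄ ≥ 2p`, B forces `a = 2` and contradicts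
`ρ₂+ρ₃ ≥ 2p`, C forces `a ≥ 3`; both `R₀` events at once need `u = −1`.) -/
theorem one_move (h : DeepCell p R0 r) {u : ℤ} (hu : 0 ≤ u) : ¬ (2 ≤ up p R0 r u ∧ 2 ≤ down p R0 r u) := by
  rintro ⟨hup, hdn⟩
  unfold up at hup
  unfold down at hdn
  have hr := h.mono
  have c1le : countEq r (p - u - 2) ≤ countLe r (p - u - 2) := countEq_le_countLe _ _
  have c12 : countEq r (p - u - 2) + countEq r (u + p) ≤ countLe r (u + p) :=
    countEq_add_countEq_le r (by omega)
  have n1 := countEq_nonneg r (p - u - 2)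
  have n2 := countEq_nonneg r (u + p)
  have h13 := h.two_p_le_r1_add_r3
  have h2 := h.R0_sub_p_lt_r2
  have h01 : r 0 ≤ r 1 := h.r_le (by decide)
  have h12 : r 1 ≤ r 2 := h.r_le (by decide)
  have h23 : r 2 ≤ r 3 := h.r_le (by decide)
  by_cases hl : R0 = 2 * p - u - 2 <;> by_cases hk : R0 = 2 * p + u
  · omega
  · -- Case B
    rw [indic_pos hl] at hup
    rw [indic_neg hk] at hdn
    have hr1 : r 1 ≤ p - u - 2 := r_le_of_countLe hr (by simp; linarith)
    have hr2 : r 2 ≤ u + p := r_le_of_countLe hr (by simp; linarith)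
    rcases h.deep with ⟨ha, _⟩ | ⟨_, ha, _⟩ | ⟨_, _, _, ha⟩ <;> omega
  · -- Case C
    rw [indic_neg hl] at hup
    rw [indic_pos hk] at hdn
    have hr2 : r 2 ≤ u + p := r_le_of_countLe hr (by simp; linarith)
    omega
  · -- Case A
    rw [indic_neg hl] at hup
    rw [indic_neg hk] at hdn
    have hr1 : r 1 ≤ p - u - 2 := r_le_of_countLe hr (by simp; linarith)
    have hr3 : r 3 ≤ u + p := r_le_of_countLe hr (by simp; linarith)
    omega

/-- **S4c as stated**: adjacent same-side classes of EQUAL defect (in particular co-dominant ones) differ by at most ONE root move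
(`up = down ≤ 1`). -/
theorem adjacent_equal_delta_moves_le_one (h : DeepCell p R0 r) {u : ℤ} (hc : IsClass p R0 u) (hu : 0 ≤ u)
    (heq : delta p R0 r (u + 2) = delta p R0 r u) : up p R0 r u = down p R0 r u ∧ up p R0 r u ≤ 1 := by
  have hs := h.delta_step hc.2.2
  have hm := h.one_move hu
  have n1 : 0 ≤ up p R0 r u := by
    unfold up; have := countEq_nonneg r (u + p); have := indic_nonneg (R0 = 2 * p - u - 2); omega
  have n2 : 0 ≤ down p R0 r u := by
    unfold down; have := countEq_nonneg r (p - u - 2); have := indic_nonneg (R0 = 2 * p + u); omega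
  constructor <;> omega

/-! ## No defect-≥-5 class is dominant: the explicit witness `u*` (THRESHOLD-X2 §5) -/

/-- `u*` is a class of the cell. -/
theorem utStar_isClass (h : DeepCell p R0 r) : IsClass p R0 (utStar p R0 r) := by
  unfold utStar IsClass
  have h0 := h.one_le_r 0
  have hp := h.odd_p
  have hp3 := h.three_le_p
  have hpar := h.parity 0
  split_ifs with h1 h2 <;> refine ⟨?_, ?_, ?_⟩ <;> omega

/-- the bump case `ρ₁ < p`, `u = p − ρ₁`: `R = 0`, `L = 1 + λ₁`, and the numerator / centre terms are controlled by `a`. -/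
theorem score_le_four_bump (h : DeepCell p R0 r) {u : ℤ} (hu : u = p - r 0) (h1 : r 0 < p) :
    score p R0 r u ≤ 4 := by
  have hr := h.mono
  have h0 := h.one_le_r 0
  have h01 : r 0 ≤ r 1 := h.r_le (by decide)
  have h12 : r 1 ≤ r 2 := h.r_le (by decide)
  have hR : countLt r (p - u) ≤ 0 := by
    have := countLt_le hr 0 (T := p - u) (by omega)
    simpa using this
  have hL4 : countLt r (u + p) ≤ 4 := by
    have := countLt_le hr 4 (T := u + p) (by have := h.two_p_le_r0_add_r4; omega)
    simpa using this
  have hc : indic (u = 0 ∨ u = p) = 0 := indic_neg (by omega)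
  have inp := indic_le_one (2 * p - R0 ≤ u)
  unfold score delta L R np nm centre
  rcases h.deep with ⟨ha, _, _, _⟩ | ⟨ha, ha', h03, _, _⟩ | ⟨ha, ha', h03, _⟩
  · -- a = 0: np = nm = 0
    have e1 : indic (2 * p - R0 ≤ u) = 0 := indic_neg (by omega)
    have e2 : indic (u ≤ R0 - 2 * p) = 0 := indic_neg (by omega)
    omega
  · -- a = 1
    have hL3 : countLt r (u + p) ≤ 3 := by
      have := countLt_le hr 3 (T := u + p) (by omega)
      simpa using this
    by_cases hn : u ≤ R0 - 2 * p
    · have hL1 : countLt r (u + p) ≤ 1 := by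
        have := countLt_le hr 1 (T := u + p) (by omega)
        simpa using this
      have e2 := indic_le_one (u ≤ R0 - 2 * p)
      omega
    · have e2 : indic (u ≤ R0 - 2 * p) = 0 := indic_neg hn
      omega
  · -- a = 2
    have hL3 : countLt r (u + p) ≤ 3 := by
      have := countLt_le hr 3 (T := u + p) (by omega)
      simpa using this
    by_cases hn : u ≤ R0 - 2 * p
    · have hL2 : countLt r (u + p) ≤ 2 := by
        have := countLt_le hr 2 (T := u + p) (by omega)
        simpa using this
      have e2 := indic_le_one (u ≤ R0 - 2 * p)
      omega
    · have e2 : indic (u ≤ R0 - 2 * p) = 0 := indic_neg hn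
      omega

/-- the well case `ρ₁ ≥ p`, `R₀` even: the centre class `u = 0` has `L = R = 0`. -/
theorem score_le_four_zero (h : DeepCell p R0 r) (h1 : ¬ r 0 < p) : score p R0 r 0 ≤ 4 := by
  have hr := h.mono
  have hL : countLt r (0 + p) ≤ 0 := by
    have := countLt_le hr 0 (T := 0 + p) (by omega)
    simpa using this
  have hR : countLt r (p - 0) ≤ 0 := by
    have := countLt_le hr 0 (T := p - 0) (by omega)
    simpa using this
  have i1 := indic_le_one (2 * p - R0 ≤ (0 : ℤ))
  have i2 := indic_le_one ((0 : ℤ) ≤ R0 - 2 * p)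
  have i3 := indic_le_one ((0 : ℤ) = 0 ∨ (0 : ℤ) = p)
  unfold score delta L R np nm centre
  omega

/-- the well case `ρ₁ ≥ p`, `R₀` odd: the class `u = 1` has `L = R = 0` (all `ρ_j` are even, hence `≥ p + 1`). -/
theorem score_le_four_one (h : DeepCell p R0 r) (h1 : ¬ r 0 < p) (h2 : ¬ R0 % 2 = 0) : score p R0 r 1 ≤ 4 := by
  have hr := h.mono
  have hp := h.odd_p
  have hp3 := h.three_le_p
  have hpar := h.parity 0
  have hL : countLt r (1 + p) ≤ 0 := by
    have := countLt_le hr 0 (T := 1 + p) (by omega)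
    simpa using this
  have hR : countLt r (p - 1) ≤ 0 := by
    have := countLt_le hr 0 (T := p - 1) (by omega)
    simpa using this
  have i1 := indic_le_one (2 * p - R0 ≤ (1 : ℤ))
  have i2 := indic_le_one ((1 : ℤ) ≤ R0 - 2 * p)
  have i3 : indic ((1 : ℤ) = 0 ∨ (1 : ℤ) = p) = 0 := indic_neg (by omega)
  unfold score delta L R np nm centre
  omega

/-- **the witness class has score ≤ 4.** -/
theorem score_utStar_le_four (h : DeepCell p R0 r) : score p R0 r (utStar p R0 r) ≤ 4 := by
  unfold utStar
  split_ifs with h1 h2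
  · exact h.score_le_four_bump rfl h1
  · exact h.score_le_four_zero h1
  · exact h.score_le_four_one h1 h2

/-- **NO ζ⁵ CLASS IS DOMINANT**: every dominant class of a deep cell has defect `δ ≤ 4` (un-amended score, `m ≥ 2`). -/
theorem dominant_delta_le_four (h : DeepCell p R0 r) {u : ℤ} (hd : IsDominant p R0 r u) : delta p R0 r u ≤ 4 := by
  obtain ⟨_, hmin⟩ := hd
  have h1 := hmin _ h.utStar_isClass
  have h2 := h.score_utStar_le_four
  have h3 := indic_nonneg (u = 0 ∨ u = p)
  unfold score centre at h1 h2
  linarith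

end DeepCell

end Summit.KontsevichZagierPeriods.Zeta5Search.DenomLaw.ThresholdModel.Rho
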